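import Literature.NumberTheory.LFunctions.AbelianFrobeniusDensity
import Mathlib.NumberTheory.NumberField.ClassNumber
import HarnessLib

/-!
# Davenport–Heilbronn for Epstein zeta functions, 0b: ideal classes, class characters, twists

Sibling of `Literature/Barriers/RiemannHypothesis/EpsteinZetaRealZeros.lean` (named fact
`DavenportHeilbronn1936b_epstein`, Davenport–Heilbronn 1936 I §4, II §§2–5). This small
DEFINITIONS file fixes the ideal-theoretic vocabulary of the Davenport–Heilbronn method for a number
field `K` (the arithmetic siblings use it for the imaginary quadratic field of the form):

* `DHEpstein.primeClass v`, `DHEpstein.idealClass 𝔞` — the class in `Cl(K) = ClassGroup (𝓞 K)` of a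
  nonzero prime, resp. of an integral ideal (`1` on the zero ideal, a junk value); the abelian
  Frobenius datum `primeClass` of `AbelianFrobeniusDensity.lean` has Artin symbol `idealClass`
  (`artinSymbol_primeClass`) and kills every ray (`artinKillsRay_primeClass`), so that for every
  character `χ` of `Cl(K)` the function `𝔭 ↦ χ([𝔭])` is a ray class character `mod (1)` of the tree
  (`IsRayClassCharacter ⊤`, `isRayClassCharacter_primeClass`). D–H I §4: "Let `χ` run through the
  characters of the group of ideal classes".
* `DHEpstein.twistCoeff χ a 𝔭 = χ([𝔭]) · a(N𝔭)` — the coefficient at the prime `𝔭` of the twisted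
  `L`-series `M(s, χ) = ∑_𝔞 χ(𝔞) a(N𝔞) N𝔞^{-s} = ∏_𝔭 (1 − χ(𝔭) a(N𝔭) N𝔭^{-s})⁻¹` of D–H I §2/§4
  (the tree's `rayClassLSeries ⊤ (twistCoeff χ a)`), for a completely multiplicative `a : ℕ →* ℂ`
  (D–H I §2 "`a(n) = a(p₁)^{ν₁} ⋯ a(p_r)^{ν_r}`"; the tree's `complMul` of
  `DavenportHeilbronnSeries.lean` builds such `a` from prime values): its multiplicative extension to
  ideals is `χ([𝔞]) a(N𝔞)` (`idealPow_twistCoeff`).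

Everything else here is elementary API. No `Prop`-valued facts are introduced.

## References

* [DavenportHeilbronn1936a] H. Davenport, H. Heilbronn, *On the zeros of certain Dirichlet series I*,
  J. London Math. Soc. 11 (1936), 181–185, §2 and §4.
* [DavenportHeilbronn1936b] — *II*, ibid. 307–312, §§2, 5. (Both read in *The Collected Papers of
  H. A. Heilbronn*, Wiley 1988, pp. 272–279.)
-/

noncomputable section

open NumberField IsDedekindDomain
open Literature.NumberTheory.LFunctions Literature.NumberTheory.LFunctions.AbelianDensity
open scoped nonZeroDivisors

namespace Literature.Barriers.RiemannHypothesis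

namespace DHEpstein

variable {K : Type*} [Field K] [NumberField K]

/-! ## Ideal classes -/

/-- The ideal class `[𝔭] ∈ Cl(K)` of a nonzero prime `𝔭` of `𝓞 K`. [folklore] -/
def primeClass (v : HeightOneSpectrum (𝓞 K)) : ClassGroup (𝓞 K) :=
  ClassGroup.mk0 ⟨v.asIdeal, mem_nonZeroDivisors_iff_ne_zero.2 v.ne_bot⟩

/-- The ideal class `[𝔞] ∈ Cl(K)` of an integral ideal (`1` on the zero ideal, a junk value).
[folklore] -/
def idealClass (I : Ideal (𝓞 K)) : ClassGroup (𝓞 K) :=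
  if h : I = ⊥ then 1 else ClassGroup.mk0 ⟨I, mem_nonZeroDivisors_iff_ne_zero.2 h⟩

/-- Unfolding `idealClass` on a nonzero ideal. [folklore] -/
theorem idealClass_of_ne_bot {I : Ideal (𝓞 K)} (hI : I ≠ ⊥) :
    idealClass I = ClassGroup.mk0 ⟨I, mem_nonZeroDivisors_iff_ne_zero.2 hI⟩ := by
  unfold idealClass; rw [dif_neg hI]

/-- `idealClass` agrees with `ClassGroup.mk0` on nonzero ideals. [folklore] -/
theorem idealClass_eq_mk0 (I : (Ideal (𝓞 K))⁰) : idealClass (I : Ideal (𝓞 K)) = ClassGroup.mk0 I := by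
  have hI : (I : Ideal (𝓞 K)) ≠ ⊥ := mem_nonZeroDivisors_iff_ne_zero.1 I.2
  rw [idealClass_of_ne_bot hI]

/-- `[𝔭]` via `idealClass`. [folklore] -/
theorem idealClass_asIdeal (v : HeightOneSpectrum (𝓞 K)) : idealClass v.asIdeal = primeClass v :=
  idealClass_of_ne_bot v.ne_bot

/-- Multiplicativity of the class on nonzero ideals. [folklore] -/
theorem idealClass_mul {I J : Ideal (𝓞 K)} (hI : I ≠ ⊥) (hJ : J ≠ ⊥) :
    idealClass (I * J) = idealClass I * idealClass J := by
  rw [idealClass_of_ne_bot hI, idealClass_of_ne_bot hJ, idealClass_of_ne_bot (mul_ne_zero hI hJ),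
    ← map_mul]
  rfl

/-- A nonzero principal ideal has trivial class. [folklore] -/
theorem idealClass_span_singleton {x : 𝓞 K} (hx : x ≠ 0) : idealClass (Ideal.span {x}) = 1 := by
  have h : Ideal.span {x} ≠ ⊥ := by rwa [Ne, Ideal.span_singleton_eq_bot]
  rw [idealClass_of_ne_bot h, ClassGroup.mk0_eq_one_iff]
  exact ⟨⟨x, rfl⟩⟩

/-- Every class is the class of some nonzero integral ideal. [folklore] -/
theorem exists_idealClass_eq (g : ClassGroup (𝓞 K)) : ∃ I : Ideal (𝓞 K), I ≠ ⊥ ∧ idealClass I = g := by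
  obtain ⟨I, hI⟩ := ClassGroup.mk0_surjective g
  exact ⟨I, mem_nonZeroDivisors_iff_ne_zero.1 I.2, by rw [idealClass_eq_mk0, hI]⟩

/-- The class of the ideal `1 = ⊤` is trivial. [folklore] -/
theorem idealClass_top : idealClass (⊤ : Ideal (𝓞 K)) = 1 := by
  rw [← Ideal.span_singleton_one]
  exact idealClass_span_singleton one_ne_zero

/-- **The class is multiplicative along a prime factorisation**:
`[∏ 𝔭^{g 𝔭}] = ∏ [𝔭]^{g 𝔭}`. [folklore] -/
theorem idealClass_finsuppProd (g : HeightOneSpectrum (𝓞 K) →₀ ℕ) :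
    idealClass (g.prod fun v k ↦ v.asIdeal ^ k) = g.prod fun v k ↦ primeClass v ^ k := by
  set G : (Ideal (𝓞 K))⁰ :=
    g.prod fun v k ↦ (⟨v.asIdeal, mem_nonZeroDivisors_iff_ne_zero.2 v.ne_bot⟩ : (Ideal (𝓞 K))⁰) ^ k
    with hG
  have hGc : (G : Ideal (𝓞 K)) = g.prod fun v k ↦ v.asIdeal ^ k := by
    rw [hG, Finsupp.prod, Finsupp.prod, Submonoid.coe_finsetProd]
    refine Finset.prod_congr rfl fun v _ ↦ ?_
    rw [SubmonoidClass.coe_pow]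
  rw [← hGc, idealClass_eq_mk0, hG, map_finsuppProd]
  refine Finsupp.prod_congr fun v _ ↦ ?_
  rw [map_pow]
  rfl

/-- **The Artin symbol of the datum `𝔭 ↦ [𝔭]` is the ideal class** (unique factorisation).
[folklore] -/
theorem artinSymbol_primeClass {I : Ideal (𝓞 K)} (hI : I ≠ ⊥) :
    artinSymbol (primeClass (K := K)) I = idealClass I := by
  obtain ⟨g, rfl⟩ := exists_finsuppProd_asIdeal_pow_eq hI
  rw [artinSymbol_finsuppProd, idealClass_finsuppProd]

/-- **The datum `𝔭 ↦ [𝔭]` kills every ray**: principal ideals have trivial class, so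
`AbelianDensity.ArtinKillsRay 𝔪 primeClass` for every `𝔪`. [folklore] -/
theorem artinKillsRay_primeClass (𝔪 : Ideal (𝓞 K)) : ArtinKillsRay 𝔪 (primeClass (K := K)) := by
  intro b c hb hc _ _ _
  have hb' : Ideal.span {b} ≠ ⊥ := by rwa [Ne, Ideal.span_singleton_eq_bot]
  have hc' : Ideal.span {c} ≠ ⊥ := by rwa [Ne, Ideal.span_singleton_eq_bot]
  rw [artinSymbol_primeClass hb', artinSymbol_primeClass hc', idealClass_span_singleton hb,
    idealClass_span_singleton hc]

/-- The prime classes generate `Cl(K)`: every class is `[𝔞] = ∏ [𝔭]^{ν_𝔭(𝔞)}`. [folklore] -/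
theorem primeClass_generate (H : Subgroup (ClassGroup (𝓞 K)))
    (hH : ∀ v : HeightOneSpectrum (𝓞 K), primeClass v ∈ H) : H = ⊤ := by
  rw [eq_top_iff]
  intro g _
  obtain ⟨I, hI, rfl⟩ := exists_idealClass_eq g
  obtain ⟨g', rfl⟩ := exists_finsuppProd_asIdeal_pow_eq hI
  rw [idealClass_finsuppProd, Finsupp.prod]
  exact prod_mem fun v _ ↦ H.pow_mem (hH v) _

/-- For a character `χ` of `Cl(K)`, `𝔭 ↦ χ([𝔭])` is a ray class character `mod (1)` (indeed modulo
any `𝔪`). [folklore] -/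
theorem isRayClassCharacter_primeClass (𝔪 : Ideal (𝓞 K)) (χ : AddChar (Additive (ClassGroup (𝓞 K))) ℂ) :
    IsRayClassCharacter 𝔪 (fun v ↦ toMulHom χ (primeClass v)) :=
  isRayClassCharacter_toMulHom (artinKillsRay_primeClass 𝔪) χ

/-- `χ([𝔞])` is the multiplicative extension of `𝔭 ↦ χ([𝔭])`. [folklore] -/
theorem idealPow_charFun_primeClass (χ : AddChar (Additive (ClassGroup (𝓞 K))) ℂ) {I : Ideal (𝓞 K)}
    (hI : I ≠ ⊥) : idealPow K (charFun primeClass χ) I = toMulHom χ (idealClass I) := by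
  unfold charFun
  rw [idealPow_comp_eq (toMulHom χ) primeClass hI, artinSymbol_primeClass hI]

/-! ## Twisted class-character coefficients -/

/-- **The coefficient `χ([𝔭]) a(N𝔭)`** at the prime `𝔭` of Davenport–Heilbronn's twisted
`L`-series `M(s, χ) = ∑_𝔞 χ(𝔞) a(N𝔞) N𝔞^{-s} = ∏_𝔭 (1 − χ(𝔭) a(N𝔭) N𝔭^{-s})⁻¹`.
[cite: DavenportHeilbronn1936a, §2 and §4] -/
def twistCoeff (χ : AddChar (Additive (ClassGroup (𝓞 K))) ℂ) (a : ℕ → ℂ)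
    (v : HeightOneSpectrum (𝓞 K)) : ℂ :=
  toMulHom χ (primeClass v) * a (Ideal.absNorm v.asIdeal)

/-- `|χ([𝔭]) a(N𝔭)| ≤ 1` when `|a| ≤ 1`. [folklore] -/
theorem norm_twistCoeff_le (χ : AddChar (Additive (ClassGroup (𝓞 K))) ℂ) {a : ℕ → ℂ}
    (ha : ∀ n, ‖a n‖ ≤ 1) (v : HeightOneSpectrum (𝓞 K)) : ‖twistCoeff χ a v‖ ≤ 1 := by
  unfold twistCoeff
  rw [norm_mul, norm_toMulHom, one_mul]
  exact ha _

/-- The hypothesis shape of the tree's Euler product: `|χ([𝔭]) a(N𝔭)| ≤ 1` off `𝔪`. [folklore] -/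
theorem norm_twistCoeff_le' (𝔪 : Ideal (𝓞 K)) (χ : AddChar (Additive (ClassGroup (𝓞 K))) ℂ)
    {a : ℕ → ℂ} (ha : ∀ n, ‖a n‖ ≤ 1) :
    ∀ v : HeightOneSpectrum (𝓞 K), ¬ 𝔪 ≤ v.asIdeal → ‖twistCoeff χ a v‖ ≤ 1 :=
  fun v _ ↦ norm_twistCoeff_le χ ha v

/-- `idealPow` of a pointwise product is the product of the `idealPow`s. [folklore] -/
theorem idealPow_mul_fun (ψ φ : HeightOneSpectrum (𝓞 K) → ℂ) {I : Ideal (𝓞 K)} (hI : I ≠ ⊥) :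
    idealPow K (fun v ↦ ψ v * φ v) I = idealPow K ψ I * idealPow K φ I := by
  unfold idealPow
  rw [← finprod_mul_distrib (mulSupport_idealPow_finite ψ hI) (mulSupport_idealPow_finite φ hI)]
  exact finprod_congr fun v ↦ mul_pow _ _ _

/-- The multiplicative extension of `𝔭 ↦ a(N𝔭)` is `𝔞 ↦ a(N𝔞)` for a completely multiplicative
`a` (the norm is multiplicative). [folklore] -/
theorem idealPow_comp_absNorm (a : ℕ →* ℂ) {I : Ideal (𝓞 K)} (hI : I ≠ ⊥) :
    idealPow K (fun v ↦ a (Ideal.absNorm v.asIdeal)) I = a (Ideal.absNorm I) := by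
  obtain ⟨g, rfl⟩ := exists_finsuppProd_asIdeal_pow_eq hI
  rw [idealPow_finsuppProd, Finsupp.prod, Finsupp.prod, map_prod, map_prod]
  refine Finset.prod_congr rfl fun v _ ↦ ?_
  rw [map_pow, map_pow]

/-- **`χ(𝔞) a(N𝔞)` is the multiplicative extension of `twistCoeff χ a`** (`𝔞 ≠ 0`). [folklore] -/
theorem idealPow_twistCoeff (χ : AddChar (Additive (ClassGroup (𝓞 K))) ℂ) (a : ℕ →* ℂ)
    {I : Ideal (𝓞 K)} (hI : I ≠ ⊥) :
    idealPow K (twistCoeff χ a) I = toMulHom χ (idealClass I) * a (Ideal.absNorm I) := by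
  have h := idealPow_mul_fun (fun v ↦ toMulHom χ (primeClass v)) (fun v ↦ a (Ideal.absNorm v.asIdeal)) hI
  unfold twistCoeff
  rw [h, idealPow_comp_absNorm a hI, ← idealPow_charFun_primeClass χ hI]
  rfl

end DHEpstein

end Literature.Barriers.RiemannHypothesis
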